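import Mathlib
import HarnessLib
import Summits.RiemannHypothesis.RiemannHypothesis.Theorems.DbrWallRungKit
import Summits.RiemannHypothesis.RiemannHypothesis.Theorems.DbrWallLogTable

/-!
# DBR column, rung B-P(P1): the GENERIC RUNG CERTIFICATE for the anti-persistence ladder (certificate half)

RH-FREE calculus / bookkeeping (LINE 1 of the label discipline) about the closed form (1.1) of Suzuki's screw function
`Ψ = Literature.NumberTheory.LFunctions.zetaScrew`; NOT worded as, and not, progress toward RH («`Ψ(2s) < 2Ψ(s)` for
all `s > 0`» stays a conjecture from data; the `∀ s` form is RH-IMPLIED, not claimed).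

With `DbrWallRungKit` (shape of the two-point gap between consecutive half-log-prime-powers; generic archimedean
lower bound) this module reduces every further rung `(log q)/2 → (log q')/2` of the ladder to ONE kernel `decide`
(validity of a finite certificate: coprime factorisations, table look-ups, integer inequalities) and ONE `norm_num`
(a closed rational inequality):

* (`DbrWallLogTable`: `LogTable` — a list of `(p, lo, hi)` with PROOFS `p` prime and `lo/10¹³ ≤ log p ≤ hi/10¹³` —
  and the table of record `logTable`, the 32 primes `p ≤ 131`);
* `PPEntry`, `RungCert`, `RungCert.valid` (a `Bool`), `RungCert.lowerBound` (a real number, explicit rational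
  arithmetic in the certificate's integers);
* `primePart_eq_sum` — at `s₁ = (log q')/2` the affine remainder of the shape lemma is
  `Σ_{n ≤ m} Λ(n)n^{−1/2} log n + Σ_{m < n ≤ q} Λ(n)n^{−1/2}(log q' − log n)` (all terms `≥ 0`);
* `lowerBound_le` — soundness: `valid ⟹ lowerBound ≤ D(s₁) + (prime part at s₁)`;
* **`ladder_step`** — `valid ⟹ 0 < lowerBound ⟹ (rung (log q)/2) ⟹ (rung (log q')/2)`.

Nothing here bears on the truth of RH. References: M. Suzuki, J. Lond. Math. Soc. (2) 108 (2023) = arXiv:2206.03682,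
(1.1) [Suzuki2023]. -/

set_option linter.dupNamespace false

noncomputable section

open scoped BigOperators
open Set
namespace Summit.RiemannHypothesis.RiemannHypothesis.Theorems.DbrWall

open Literature.NumberTheory.LFunctions

/-! ### Certificates -/

/-- One prime power `n = p^k ≤ q` used in the lower bound, with `s/10⁶ ≥ √n` and the table bounds `lo, hi` of
`log p` copied in. [folklore] -/
structure PPEntry where
  /-- the prime power -/
  n : ℕ
  /-- its prime -/
  p : ℕ
  /-- its exponent -/
  k : ℕ
  /-- `s/10⁶ ≥ √n` -/
  s : ℕ
  /-- table lower bound of `log p` (units `10⁻¹³`) -/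
  lo : ℕ
  /-- table upper bound of `log p` (units `10⁻¹³`) -/
  hi : ℕ

/-- A rung certificate for the piece `[(log q)/2, (log q')/2]`: `q < q'` consecutive prime powers, `q' = p'^{K'}`,
`m ≤ m'` consecutive prime powers with `m² ≤ q`, `q' ≤ m'²`, coprime-factorisation witnesses for the integers
strictly between, fourth-root brackets `a/10⁶ ≤ q'^{1/4} ≤ b/10⁶`, `c/10⁵ ≥ q'^{−1/4}`, and the prime powers used.
[folklore] -/
structure RungCert where
  /-- left end `(log q)/2` -/
  q : ℕ
  /-- right end `(log q')/2` -/
  q' : ℕ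
  /-- largest prime power with `m² ≤ q` -/
  m : ℕ
  /-- next prime power after `m` -/
  m' : ℕ
  /-- `q' = p'^{K'}` -/
  p' : ℕ
  /-- `q' = p'^{K'}` -/
  K' : ℕ
  /-- table lower bound of `log p'` (units `10⁻¹³`) -/
  lo' : ℕ
  /-- coprime factorisations of the integers strictly between `q` and `q'` -/
  Lq : List (ℕ × ℕ)
  /-- coprime factorisations of the integers strictly between `m` and `m'` -/
  Lm : List (ℕ × ℕ)
  /-- `a/10⁶ ≤ q'^{1/4}` -/
  a : ℕ
  /-- `q'^{1/4} ≤ b/10⁶` -/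
  b : ℕ
  /-- `q'^{−1/4} ≤ c/10⁵` -/
  c : ℕ
  /-- the prime powers `≤ q` used in the lower bound -/
  pp : List PPEntry

/-- Validity of one prime-power entry (all checks are integer arithmetic / table look-ups). [folklore] -/
def PPEntry.valid (T : LogTable) (C : RungCert) (e : PPEntry) : Bool :=
  decide (T.lookup e.p = some (e.lo, e.hi) ∧ 1 ≤ e.k ∧ e.p ^ e.k = e.n ∧ 1 ≤ e.n ∧ e.n ≤ C.q
    ∧ e.n * 10 ^ 12 ≤ e.s * e.s ∧ (e.n ≤ C.m ∨ e.k * e.hi ≤ C.K' * C.lo'))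

/-- Validity of a rung certificate (kernel-decidable). [folklore] -/
def RungCert.valid (T : LogTable) (C : RungCert) : Bool :=
  decide (2 ≤ C.q ∧ C.q ≤ C.q' ∧ 1 ≤ C.m ∧ C.m ≤ C.m' ∧ C.m * C.m ≤ C.q ∧ C.q' ≤ C.m' * C.m'
      ∧ 1 ≤ C.K' ∧ C.p' ^ C.K' = C.q' ∧ (T.lookup C.p').map Prod.fst = some C.lo'
      ∧ C.a ^ 4 ≤ C.q' * 10 ^ 24 ∧ C.q' * 10 ^ 24 ≤ C.b ^ 4 ∧ 10 ^ 11 ≤ C.c * C.a ∧ C.c ≤ 10 ^ 5)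
    && noPrimePowBetween C.q C.q' C.Lq && noPrimePowBetween C.m C.m' C.Lm
    && (C.pp.map PPEntry.n).Nodup && C.pp.all (PPEntry.valid T C)

/-- Lower bound of the weight of an entry: `k·lo` (`n ≤ m`, weight `log n`) or `K'·lo' − k·hi` (`n > m`, weight
`log q' − log n`), units `10⁻¹³`. [folklore] -/
def PPEntry.wlo (C : RungCert) (e : PPEntry) : ℝ :=
  if e.n ≤ C.m then (e.k : ℝ) * e.lo else (C.K' : ℝ) * C.lo' - (e.k : ℝ) * e.hi

/-- Lower bound of the prime term of an entry: `(lo/10¹³)(wlo/10¹³)/(s/10⁶)`. [folklore] -/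
def PPEntry.lb (C : RungCert) (e : PPEntry) : ℝ :=
  (e.lo : ℝ) / 10 ^ 13 * (e.wlo C / 10 ^ 13) / ((e.s : ℝ) / 10 ^ 6)

/-- **The certificate's lower bound** for `F((log q')/2) = 2Ψ − Ψ(2·)` at the new end-point: twenty archimedean terms,
the telescoping tail, `−4(b/10⁶ − 1)²`, and the prime-term lower bounds. [folklore] -/
def RungCert.lowerBound (C : RungCert) : ℝ :=
  (∑ k ∈ Finset.range 20, (1 - (1 / (C.q' : ℝ)) ^ (k + 1) * ((C.c : ℝ) / 10 ^ 5)) ^ 2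
      / (2 * (k : ℝ) + 5 / 2) ^ 2)
    + (1 - (1 / (C.q' : ℝ)) ^ 21) ^ 2 / 85 - 4 * ((C.b : ℝ) / 10 ^ 6 - 1) ^ 2
    + (C.pp.map (PPEntry.lb C)).sum

/-! ### The prime part at the new end-point -/

/-- The weight of `n` in the prime part at `(log q')/2`: `log n` for `n ≤ m`, `log q' − log n` beyond. [folklore] -/
def primeWeight (C : RungCert) (n : ℕ) : ℝ :=
  if n ≤ C.m then Real.log n else Real.log C.q' - Real.log n

/-- **Prime part at `s₁ = (log q')/2`**: the affine remainder of the shape lemma evaluates to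
`Σ_{1 ≤ n ≤ q} Λ(n)n^{−1/2}·w(n)`, `w(n) = log n` (`n ≤ m`), `= log q' − log n` (`m < n ≤ q`). [folklore] -/
theorem primePart_eq_sum (C : RungCert) (hm : 1 ≤ C.m) (hmq : C.m ≤ C.q) :
    Real.log 2 / Real.sqrt 2 * (2 * (Real.log C.q' / 2) - Real.log 2)
      + ((2 * primeSumA C.q - 2 * primeSumA C.m - 2 * (Real.log 2 / Real.sqrt 2)) * (Real.log C.q' / 2)
        + (2 * primeSumB C.m - primeSumB C.q + Real.log 2 / Real.sqrt 2 * Real.log 2))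
    = ∑ n ∈ Finset.Icc 1 C.q, ArithmeticFunction.vonMangoldt n / Real.sqrt n * primeWeight C n := by
  have hsplit : Finset.Icc 1 C.q = Finset.Icc 1 C.m ∪ Finset.Ioc C.m C.q := by
    ext n; simp only [Finset.mem_union, Finset.mem_Icc, Finset.mem_Ioc]; omega
  have hdisj : Disjoint (Finset.Icc 1 C.m) (Finset.Ioc C.m C.q) := by
    rw [Finset.disjoint_left]; intro n h1 h2
    rw [Finset.mem_Icc] at h1; rw [Finset.mem_Ioc] at h2; omega
  have hw1 : ∀ n ∈ Finset.Icc 1 C.m, ArithmeticFunction.vonMangoldt n / Real.sqrt n * primeWeight C n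
      = ArithmeticFunction.vonMangoldt n / Real.sqrt n * Real.log n := by
    intro n hn; rw [Finset.mem_Icc] at hn; rw [primeWeight, if_pos hn.2]
  have hw2 : ∀ n ∈ Finset.Ioc C.m C.q, ArithmeticFunction.vonMangoldt n / Real.sqrt n * primeWeight C n
      = ArithmeticFunction.vonMangoldt n / Real.sqrt n * (Real.log C.q' - Real.log n) := by
    intro n hn; rw [Finset.mem_Ioc] at hn; rw [primeWeight, if_neg (by omega)]
  rw [hsplit, Finset.sum_union hdisj, Finset.sum_congr rfl hw1, Finset.sum_congr rfl hw2]
  simp only [primeSumA, primeSumB]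
  rw [hsplit, Finset.sum_union hdisj, Finset.sum_union hdisj]
  have e1 : ∑ n ∈ Finset.Ioc C.m C.q, ArithmeticFunction.vonMangoldt n / Real.sqrt n
      * (Real.log C.q' - Real.log n) = Real.log C.q' * ∑ n ∈ Finset.Ioc C.m C.q,
        ArithmeticFunction.vonMangoldt n / Real.sqrt n
      - ∑ n ∈ Finset.Ioc C.m C.q, ArithmeticFunction.vonMangoldt n / Real.sqrt n * Real.log n := by
    rw [Finset.mul_sum, ← Finset.sum_sub_distrib]
    exact Finset.sum_congr rfl fun n _ => by ring
  rw [e1]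
  ring

/-- Every term of the prime part is `≥ 0` (`1 ≤ n ≤ q ≤ q'`). [folklore] -/
theorem primeTerm_nonneg (C : RungCert) (hqq' : C.q ≤ C.q') {n : ℕ} (hn : n ∈ Finset.Icc 1 C.q) :
    0 ≤ ArithmeticFunction.vonMangoldt n / Real.sqrt n * primeWeight C n := by
  rw [Finset.mem_Icc] at hn
  have hΛ : 0 ≤ (ArithmeticFunction.vonMangoldt n : ℝ) := ArithmeticFunction.vonMangoldt_nonneg
  have hw : 0 ≤ primeWeight C n := by
    unfold primeWeight
    split_ifs
    · exact Real.log_natCast_nonneg n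
    · have hn0 : (0 : ℝ) < n := by exact_mod_cast hn.1
      have : Real.log n ≤ Real.log C.q' := Real.log_le_log hn0 (by exact_mod_cast hn.2.trans hqq')
      linarith
  exact mul_nonneg (div_nonneg hΛ (Real.sqrt_nonneg _)) hw

/-- **Soundness of one entry**: its rational lower bound is below its prime term. [folklore] -/
theorem PPEntry.lb_le (T : LogTable) (C : RungCert) (hK : C.p' ^ C.K' = C.q')
    (hlo' : ∃ hi, T.lookup C.p' = some (C.lo', hi)) (e : PPEntry) (hv : e.valid T C = true) :
    e.lb C ≤ ArithmeticFunction.vonMangoldt e.n / Real.sqrt e.n * primeWeight C e.n := by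
  rw [PPEntry.valid, decide_eq_true_eq] at hv
  obtain ⟨hlook, hk, hpk, hn1, -, hs, hor⟩ := hv
  obtain ⟨hp, hplo, hphi⟩ := T.lookup_sound hlook
  have hk0 : e.k ≠ 0 := by omega
  have hΛ : (ArithmeticFunction.vonMangoldt e.n : ℝ) = Real.log e.p := by
    rw [← hpk, ArithmeticFunction.vonMangoldt_apply_pow hk0, ArithmeticFunction.vonMangoldt_apply_prime hp]
  have hp0 : (0 : ℝ) < e.p := by exact_mod_cast hp.pos
  have hlogn : Real.log e.n = e.k * Real.log e.p := by
    rw [← hpk]; push_cast; rw [Real.log_pow]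
  have hlogp0 : 0 ≤ Real.log e.p := Real.log_natCast_nonneg _
  have hlo0 : (0 : ℝ) ≤ (e.lo : ℝ) / 10 ^ 13 := by positivity
  -- the square root
  have hn0 : (0 : ℝ) < e.n := by exact_mod_cast hn1
  have hsqrt0 : 0 < Real.sqrt e.n := Real.sqrt_pos.2 hn0
  have hsqrt : Real.sqrt e.n ≤ (e.s : ℝ) / 10 ^ 6 := by
    have hs' : (e.n : ℝ) * 10 ^ 12 ≤ (e.s : ℝ) * e.s := by exact_mod_cast hs
    have h1 : (e.n : ℝ) ≤ ((e.s : ℝ) / 10 ^ 6) ^ 2 := by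
      rw [div_pow, le_div_iff₀ (by positivity)]; nlinarith [hs']
    calc Real.sqrt e.n ≤ Real.sqrt (((e.s : ℝ) / 10 ^ 6) ^ 2) := Real.sqrt_le_sqrt h1
      _ = (e.s : ℝ) / 10 ^ 6 := Real.sqrt_sq (by positivity)
  -- the weight
  have hw : e.wlo C / 10 ^ 13 ≤ primeWeight C e.n ∧ 0 ≤ e.wlo C / 10 ^ 13 := by
    unfold PPEntry.wlo primeWeight
    by_cases hnm : e.n ≤ C.m
    · rw [if_pos hnm, if_pos hnm, hlogn]
      refine ⟨?_, by positivity⟩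
      rw [mul_div_assoc]
      exact mul_le_mul_of_nonneg_left hplo (Nat.cast_nonneg _)
    · rw [if_neg hnm, if_neg hnm, hlogn]
      have hkh : (e.k : ℝ) * e.hi ≤ (C.K' : ℝ) * C.lo' := by
        rcases hor with h | h
        · exact absurd h hnm
        · exact_mod_cast h
      obtain ⟨hi', hlook'⟩ := hlo'
      obtain ⟨-, hp'lo, -⟩ := T.lookup_sound hlook'
      have hlogq' : Real.log C.q' = C.K' * Real.log C.p' := by
        rw [← hK]; push_cast; rw [Real.log_pow]
      rw [hlogq']
      refine ⟨?_, div_nonneg (sub_nonneg.2 hkh) (by norm_num)⟩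
      rw [sub_div]
      have h1 : (C.K' : ℝ) * C.lo' / 10 ^ 13 ≤ (C.K' : ℝ) * Real.log C.p' := by
        rw [mul_div_assoc]; exact mul_le_mul_of_nonneg_left hp'lo (Nat.cast_nonneg _)
      have h2 : (e.k : ℝ) * Real.log e.p ≤ (e.k : ℝ) * e.hi / 10 ^ 13 := by
        rw [mul_div_assoc]; exact mul_le_mul_of_nonneg_left hphi (Nat.cast_nonneg _)
      linarith
  obtain ⟨hwle, hwlo0⟩ := hw
  have hw0 : 0 ≤ primeWeight C e.n := hwlo0.trans hwle
  -- assemble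
  have eq : Real.log e.p / Real.sqrt e.n * primeWeight C e.n
      = Real.log e.p * primeWeight C e.n / Real.sqrt e.n := by ring
  rw [PPEntry.lb, hΛ, eq]
  exact div_le_div₀ (mul_nonneg hlogp0 hw0) (mul_le_mul hplo hwle hwlo0 hlogp0) hsqrt0 hsqrt

/-- **Soundness of the prime-term list**: `Σ_{entries} lb ≤ Σ_{1 ≤ n ≤ q} Λ(n)n^{−1/2} w(n)`. [folklore] -/
theorem sum_lb_le (T : LogTable) (C : RungCert) (hqq' : C.q ≤ C.q') (hK : C.p' ^ C.K' = C.q')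
    (hlo' : ∃ hi, T.lookup C.p' = some (C.lo', hi)) (hnd : (C.pp.map PPEntry.n).Nodup)
    (hall : C.pp.all (PPEntry.valid T C) = true) :
    (C.pp.map (PPEntry.lb C)).sum
      ≤ ∑ n ∈ Finset.Icc 1 C.q, ArithmeticFunction.vonMangoldt n / Real.sqrt n * primeWeight C n := by
  set f : ℕ → ℝ := fun n => ArithmeticFunction.vonMangoldt n / Real.sqrt n * primeWeight C n with hf
  have hall' := List.all_eq_true.1 hall
  have h1 : (C.pp.map (PPEntry.lb C)).sum ≤ (C.pp.map (f ∘ PPEntry.n)).sum :=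
    List.sum_le_sum fun e he => PPEntry.lb_le T C hK hlo' e (hall' e he)
  have h2 : (C.pp.map (f ∘ PPEntry.n)).sum = ∑ n ∈ (C.pp.map PPEntry.n).toFinset, f n := by
    rw [← List.map_map, List.sum_toFinset _ hnd]
  have hsub : (C.pp.map PPEntry.n).toFinset ⊆ Finset.Icc 1 C.q := by
    intro n hn
    rw [List.mem_toFinset, List.mem_map] at hn
    obtain ⟨e, he, rfl⟩ := hn
    have hv := hall' e he
    rw [PPEntry.valid, decide_eq_true_eq] at hv
    rw [Finset.mem_Icc]; exact ⟨hv.2.2.2.1, hv.2.2.2.2.1⟩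
  have h3 : ∑ n ∈ (C.pp.map PPEntry.n).toFinset, f n ≤ ∑ n ∈ Finset.Icc 1 C.q, f n :=
    Finset.sum_le_sum_of_subset_of_nonneg hsub fun n hn _ => primeTerm_nonneg C hqq' hn
  exact h1.trans (h2.le.trans h3)

/-! ### The rung theorem -/

/-- **Generic ladder step** (RH-FREE): a valid rung certificate with positive lower bound carries the
anti-persistence inequality `Ψ(2s) < 2Ψ(s)` from `0 < s ≤ (log q)/2` to `0 < s ≤ (log q')/2`. [folklore] -/
theorem ladder_step (T : LogTable) (C : RungCert) (hv : C.valid T = true) (hlb : 0 < C.lowerBound)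
    (hprev : ∀ s : ℝ, 0 < s → s ≤ Real.log C.q / 2 → zetaScrew (2 * s) < 2 * zetaScrew s)
    {s : ℝ} (hs0 : 0 < s) (hs : s ≤ Real.log C.q' / 2) : zetaScrew (2 * s) < 2 * zetaScrew s := by
  -- unpack validity
  rw [RungCert.valid] at hv
  simp only [Bool.and_eq_true, decide_eq_true_eq] at hv
  obtain ⟨⟨⟨⟨⟨hq2, hqq', hm1, hmm', hmq, hq'm', hK1, hK, hlo', ha4, hb4, hca, hc5⟩, hLq⟩, hLm⟩, hnd⟩,
    hall⟩ := hv
  have hlo'' := T.exists_lookup_of_map_fst hlo'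
  have hq'1 : 1 ≤ C.q' := by omega
  have hq'2 : 2 ≤ C.q' := by omega
  have hmq' : C.m ≤ C.q := le_trans (by nlinarith) hmq
  rcases le_total s (Real.log C.q / 2) with h | h
  · exact hprev s hs0 h
  have hx : Real.log 2 / 2 ≤ Real.log C.q / 2 := by
    have := Real.log_le_log (by norm_num) (show (2 : ℝ) ≤ C.q by exact_mod_cast hq2); linarith
  have hq0 : 0 < Real.log C.q / 2 := by
    have := Real.log_pos (show (1 : ℝ) < C.q by exact_mod_cast (by omega : 1 < C.q)); positivity
  have hxy : Real.log C.q / 2 ≤ Real.log C.q' / 2 := by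
    have := Real.log_le_log (by exact_mod_cast (by omega : 0 < C.q)) (show (C.q : ℝ) ≤ C.q' by
      exact_mod_cast hqq')
    linarith
  have hshape := two_mul_zetaScrew_sub_shape hm1 hmm' hqq' hmq hq'm'
    (vonMangoldt_eq_zero_of_noPrimePowBetween hLq) (vonMangoldt_eq_zero_of_noPrimePowBetween hLm)
  have h0 : 0 < 2 * zetaScrew (Real.log C.q / 2) - zetaScrew (2 * (Real.log C.q / 2)) := by
    have := hprev _ hq0 le_rfl; linarith
  -- the certificate at the right end-point
  have h1 : 0 < 2 * zetaScrew (Real.log C.q' / 2) - zetaScrew (2 * (Real.log C.q' / 2)) := by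
    rw [hshape (Real.log C.q' / 2) hxy le_rfl]
    -- fourth-root brackets
    have ha' : ((C.a : ℝ) / 10 ^ 6) ^ 4 ≤ C.q' := by
      rw [div_pow, div_le_iff₀ (by positivity)]; exact_mod_cast ha4
    have hb' : (C.q' : ℝ) ≤ ((C.b : ℝ) / 10 ^ 6) ^ 4 := by
      rw [div_pow, le_div_iff₀ (by positivity)]; exact_mod_cast hb4
    obtain ⟨hra, hrb⟩ := exp_log_div_four_bounds_of hq'1 (by positivity) ha' hb'
    have hr1 := one_le_exp_log_div_four hq'1
    have ha0 : 0 < C.a := Nat.pos_of_ne_zero (by rintro h; rw [h, mul_zero] at hca; norm_num at hca)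
    have haR : (0 : ℝ) < C.a := by exact_mod_cast ha0
    have hapos : (0 : ℝ) < (C.a : ℝ) / 10 ^ 6 := by positivity
    have hca' : (10 : ℝ) ^ 11 ≤ (C.c : ℝ) * C.a := by exact_mod_cast hca
    have hrc : (Real.exp (Real.log C.q' / 4))⁻¹ ≤ (C.c : ℝ) / 10 ^ 5 := by
      have h1 : (Real.exp (Real.log C.q' / 4))⁻¹ ≤ ((C.a : ℝ) / 10 ^ 6)⁻¹ := inv_anti₀ hapos hra
      have h2 : ((C.a : ℝ) / 10 ^ 6)⁻¹ ≤ (C.c : ℝ) / 10 ^ 5 := by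
        rw [inv_div, div_le_div_iff₀ haR (by positivity)]
        nlinarith [hca']
      exact h1.trans h2
    have hc0 : (0 : ℝ) ≤ (C.c : ℝ) / 10 ^ 5 := by positivity
    have hc1 : (C.c : ℝ) / 10 ^ 5 ≤ 1 := by
      rw [div_le_one (by positivity)]; exact_mod_cast hc5
    have hgap := gap_half_log_ge hq'2 hc0 hc1 hrc hrb
    have hprime := primePart_eq_sum C hm1 hmq'
    have hlbs := sum_lb_le T C hqq' hK hlo'' hnd hall
    rw [RungCert.lowerBound] at hlb
    have e : (∑' k : ℕ, (1 - Real.exp (-((2 * (k : ℝ) + 5 / 2) * (Real.log C.q' / 2)))) ^ 2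
          / (2 * (k : ℝ) + 5 / 2) ^ 2)
        - 4 * (Real.exp (Real.log C.q' / 2 / 2) - 1) ^ 2
        + Real.log 2 / Real.sqrt 2 * (2 * (Real.log C.q' / 2) - Real.log 2)
        + ((2 * primeSumA C.q - 2 * primeSumA C.m - 2 * (Real.log 2 / Real.sqrt 2)) * (Real.log C.q' / 2)
          + (2 * primeSumB C.m - primeSumB C.q + Real.log 2 / Real.sqrt 2 * Real.log 2))
        = ((∑' k : ℕ, (1 - Real.exp (-((2 * (k : ℝ) + 5 / 2) * (Real.log C.q' / 2)))) ^ 2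
          / (2 * (k : ℝ) + 5 / 2) ^ 2)
        - 4 * (Real.exp (Real.log C.q' / 2 / 2) - 1) ^ 2)
        + ∑ n ∈ Finset.Icc 1 C.q, ArithmeticFunction.vonMangoldt n / Real.sqrt n * primeWeight C n := by
      rw [← hprime]; ring
    rw [e]
    linarith
  exact zetaScrew_two_mul_lt_two_mul_of_piece hx hshape h0 h1 h hs

end Summit.RiemannHypothesis.RiemannHypothesis.Theorems.DbrWall
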